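import Mathlib.Analysis.Complex.Basic
import Mathlib.Analysis.SpecialFunctions.Pow.Real
import Mathlib.Analysis.SpecialFunctions.Sqrt
import Literature.IUT.HodgeArakelov.GlobalGaussianRealifiedBridge
import Literature.IUT.HodgeArakelov.GlobalGaussianFrobenioidsCor46Proofs
import Literature.IUT.HodgeArakelov.GoodPrimeFrobenioidMonoidsProofs
import Literature.IUT.HodgeArakelov.ArchRealifiedConstantMonoids
import HarnessLib

/-!
# [IUTchII] Remarks 4.5.4, 4.6.1, 4.7.6, 4.8.1 (i)–(iii): the small printed clauses with a mathematical kernel,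
# PROVED at the cell's models — proof companion of `GlobalGaussianFrobenioids.lean`

S. Mochizuki, *Inter-universal Teichmüller theory II*, §4, kurims manuscript (Dec. 2020), read on the page this
session (cell render `IUTchII-kurims-url-5036b4059555`, line-identical with the store copy on pp. 2–174):
Remark 4.5.4 p. 136 l. 41–51; Remark 4.6.1 p. 139 l. 86 – p. 140 l. 27; Remark 4.8.1 (i) p. 151 l. 58 – p. 152
l. 18, (ii) p. 152 l. 19–52, (iii) p. 152 l. 53–67 [cite: Mochizuki2012, Rmk 4.8.1 p.151]. Claim key DISPUTED (D-0012). PROOF-ONLY companion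
(abc-iut cell, layer L6, seat abc-iut-w4-d035 gen 8, rows IUTchII:Rmk4.5.4, Rmk4.6.1, Rmk4.8.1(i)(ii)(iii) of the
L6-t2 typer lineage p404130; the Rmk 4.7.3 (iii) / 4.7.4 (ii) companion is `SymmetryCombinatoricsRmk474Proofs.lean`): NO definition, NO `Prop` fact,
NO instance — theorems about objects already REAL in the tree.

WHAT IS PROVED (every item is the printed clause, read at the model named):

* **Rmk 4.5.4** (p. 136 l. 45–51: "the divisor monoid (respectively, rational function monoid) of this
  Frobenioid consists of elements of the form `(1²·φ, 2²·φ, …, j²·φ, …)` (respectively,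
  `(1²·β, 2²·β, …, j²·β, …)`)"): at the REAL initial Θ-data (`phiGau D = Φ_{C⊩_gau}`, p406619) membership is
  exactly the printed shape (`mem_phiGau_iff`); for the rational function monoid (a GROUP `B`) the same
  shape is stable under inverses (`neg_mem_weightedDiagonal`), i.e. the weighted diagonal of a group is a group.
* **Rmk 4.6.1** (p. 139 l. 86 – p. 140 l. 15): at `v ∈ V^non` the distinguished element of
  `Ψ^R_{†F⊢_v} = (Ψ_{†F⊢_v}/Ψ^×_{†F⊢_v})^rlf` "determined by the unique generator of `Ψ_{†F⊢_v}/Ψ^×_{†F⊢_v}`" (Prop 4.2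
  (ii)) is INTRINSIC — every automorphism of the value monoid `ℕ` fixes its generator
  (`Nat.addEquiv_eq_refl`, `Nat.addEquiv_map_one`), so any automorphism of `†F⊢_v` preserves it ("may be
  reconstructed algorithmically from `†F⊢_v`"); at `v ∈ V^arc` "the distinguished element … [i.e., of
  `Ψ^R_{†F⊢_v}`] is not preserved by arbitrary automorphisms of `†F⊢_v`": at the model `𝒪^▷_ℂ` (abc-iut-L5-t2
  `unitDiscMonoid ℂ`, distinguished class = norm `e⁻¹`, `GoodPrimeKummer.expNegOne`) the monoid
  automorphism `z ↦ z·|z|` moves the distinguished class (`exists_mulEquiv_unitDisc_not_associated`).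
  The third clause ("currency exchange": the archimedean distinguished elements are computable from the
  nonarchimedean ones and the global Frobenioid) is the subject of a separate file.
* **Rmk 4.8.1 (i)** (p. 151 l. 58 – p. 152 l. 18: `C⊩_gau(†HT^Θ) ↪ ∏_j (†ℱ^⊛ℝ_mod)_j` via the isomorphisms
  `†C⊩_j ⥲ (†ℱ^⊛ℝ_mod)_j` of Cor 4.8 (iii)): componentwise transport along an additive ISOMORPHISM is
  injective on the product (`compLeft_injective`) and carries the weighted diagonal onto the weighted
  diagonal (`map_weightedDiagonal_addEquiv`) — the transported `C⊩_gau` is again "the weighted diagonal" of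
  the target; **(ii)** (p. 152 l. 19–52: `ℱ_gau(†HT^Θ)^ℝ ↪ ∏_j (†ℱ^ℝ_>)_j ⥲ ∏_j †ℱ^ℝ_j` via "the full
  poly-isomorphisms `(†ℱ_>)_j ⥲ †ℱ_j` — which are tautologically compatible with the labels"): at each `v`
  the realified Gaussian monoid inside `∏_j ℝ_{≥0}` is `{(j²·r)_j}` (`mem_weightedDiagonal_nnreal_iff`), and the
  embedding does not depend on the member of the poly-isomorphism chosen, because two isomorphisms of
  pointed half-lines matching the distinguished elements COINCIDE (IN THE TREE, consumed by name:
  `PointedHalfLine.addEquiv_eq_of_map_pt` / `family_addEquiv_eq_of_map_pt`, `BiCoresRealifiedRigidity.lean` p412780,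
  from abc-iut-L6-t2's `isoUnique_holds`) and scaling carries the local weighted diagonal onto itself
  (`map_weightedDiagonal_scaleIso`); **(iii)** (p. 152 l. 53–67: the "realified localization" functor
  `C⊩_gau(†HT^Θ) → ℱ_gau(†HT^Θ)^ℝ` "compatible … with the realified localization isomorphisms
  `Φ_{C⊩_gau,v} ⥲ Ψ_{ℱ_gau}(†HT^Θ)^ℝ_v`"): reading the `v`-components of an element of `Φ_{C⊩_gau}` through
  [IUTchI] Ex 3.5 (i)'s `ρ_w` lands in the local weighted diagonal (`rho_phiGau_mem_weightedDiagonal`) and, on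
  the global evaluation isomorphism, IS the local weighted diagonal of the local value
  (`rho_thtToGau_eq_weightedDiagonalHom`, packaging p406619's `rho_thtToGau`).

* **Rmk 4.7.6** (v2 append; p. 148 l. 46 – p. 149 l. 4, CITED in the proof of [IUTchIII] Cor 3.12: forming the
  quotient by the `F_l^⋇`-symmetries "would give rise to «label-crushing», i.e., to identifying to a single point the
  distinct labels `j ∈ F_l^⋇`"): at abc-iut-L5's torsor of labels (`IsTorsor`, [IUTchI] Def 4.1 (ii)) the orbit
  quotient by `G` is ONE point (`IsTorsor.subsingleton_orbitRel_quotient`) and every `G`-invariant assignment on the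
  labels is constant (`IsTorsor.eq_of_invariant`).

* **Rmk 4.6.1, nonarchimedean clause at the model** (v3 append): for `Ψ/Ψ^× ≅ ℕ` (Prop 4.2 (ii) "unique
  generator") every automorphism of `Ψ` preserves every class modulo units (`associatesMk_apply_eq_of_equiv_nat`);
  contrapositive `isEmpty_equiv_nat_of_moves_class`; `𝒪^▷_ℂ/𝒪^×_ℂ` is not `ℕ` (`isEmpty_associates_unitDisc_equiv_nat`).

HONEST FRAMING. Elementary algebra/combinatorics over the cell's own models and normalisations; nothing here
bears on [IUTchIII] Cor. 3.12 or takes a side; typed ≠ discharged elsewhere; covered ≠ endorsed.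
-/

namespace Literature.IUT.HodgeArakelov

open scoped NNReal
open Literature.IUT.HodgeTheaters

universe u v w u'

/-! ### 1. Remark 4.5.4: the printed shape of `Φ_{C⊩_gau}` at the initial Θ-data -/

section Rmk454

variable {F : Type u} {K : Type v} {Fbar : Type w} [Field F] [NumberField F] [Field K]
  [NumberField K] [Algebra F K] [Field Fbar] [Algebra F Fbar] [Algebra K Fbar]
  {E : WeierstrassCurve F} [E.IsElliptic] {l : ℕ} {P : BadPlacePredicates K}

/-- **[IUTchII] Rmk 4.5.4** (p. 136 l. 45–51: "the divisor monoid … of this Frobenioid consists of elements of the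
form `(1²·φ, 2²·φ, …, j²·φ, …)` — where `φ` … is an element of the divisor monoid … associated to the Frobenioid
`D⊩(†𝒟⊢_≻)`"), at the REAL initial Θ-data: membership in `Φ_{C⊩_gau} = phiGau D` is exactly the printed shape
(`j = i + 1`). [cite: Mochizuki2012, Rmk 4.5.4 p.136] -/
theorem mem_phiGau_iff (D : InitialThetaData F K Fbar E l P) (x : Fin (lStar l) → D.PhiMod) :
    x ∈ phiGau D ↔ ∃ φ : D.PhiMod, ∀ i : Fin (lStar l), x i = ((i.val + 1) ^ 2 : ℕ) • φ :=
  mem_weightedDiagonal_iff D.PhiMod (lStar l) x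

end Rmk454

section Rmk454Group

variable {B : Type u} [AddCommGroup B] (lstar : ℕ)

/-- **[IUTchII] Rmk 4.5.4**, "respectively, rational function monoid … `(1²·β, 2²·β, …, j²·β, …)`" (p. 136
l. 46–51): for a GROUP `B` (the rational function monoid is a group) the weighted diagonal is stable under
inverses — the inverse of `(j²·β)_j` is `(j²·(−β))_j`. [cite: Mochizuki2012, Rmk 4.5.4 p.136] -/
theorem neg_mem_weightedDiagonal {x : Fin lstar → B} (hx : x ∈ weightedDiagonal B lstar) :
    -x ∈ weightedDiagonal B lstar := by
  rw [mem_weightedDiagonal_iff] at hx ⊢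
  obtain ⟨β, hβ⟩ := hx
  refine ⟨-β, fun i => ?_⟩
  rw [Pi.neg_apply, hβ i, smul_neg]

/-- Hence differences of elements of the weighted diagonal of a group stay in it: the rational-function
weighted diagonal is a subgroup of `∏_j B_j`. [cite: Mochizuki2012, Rmk 4.5.4 p.136] -/
theorem sub_mem_weightedDiagonal {x y : Fin lstar → B} (hx : x ∈ weightedDiagonal B lstar)
    (hy : y ∈ weightedDiagonal B lstar) : x - y ∈ weightedDiagonal B lstar := by
  rw [sub_eq_add_neg]
  exact add_mem hx (neg_mem_weightedDiagonal lstar hy)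

end Rmk454Group

/-! ### 2. Remark 4.8.1 (i): transport of the weighted diagonal along `†C⊩_j ⥲ (†ℱ^⊛ℝ_mod)_j` -/

section Rmk481i

variable {Φ : Type u} {Φ' : Type v} [AddCommMonoid Φ] [AddCommMonoid Φ'] (lstar : ℕ)

/-- **[IUTchII] Rmk 4.8.1 (i)** (p. 152 l. 2–18: "one may apply the isomorphism `†C⊩_j ⥲ (†ℱ^⊛ℝ_mod)_j` of Corollary
4.8, (iii), to regard this Frobenioid `C⊩_gau(†HT^Θ)` as a subcategory `C⊩_gau(†HT^Θ) ↪ ∏_{j ∈ F_l^⋇} (†ℱ^⊛ℝ_mod)_j`"), at the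
divisor monoids: applying ONE additive isomorphism `e` at every label `j` is INJECTIVE on the product — the
transported `C⊩_gau` is indeed a sub-object of `∏_j (†ℱ^⊛ℝ_mod)_j`. [cite: Mochizuki2012, Rmk 4.8.1 (i) p.152] -/
theorem compLeft_injective {f : Φ →+ Φ'} (hf : Function.Injective f) :
    Function.Injective (AddMonoidHom.compLeft f (Fin lstar)) := by
  intro x y h
  funext i
  exact hf (congrFun h i)

/-- **[IUTchII] Rmk 4.8.1 (i)** (p. 151 l. 58 – p. 152 l. 18), at the divisor monoids: transporting the weighted
diagonal `Φ_{C⊩_gau} ⊆ ∏_j Φ_{†C⊩}` along the labelled family of ONE isomorphism `e : Φ_{†C⊩} ⥲ Φ_{(†ℱ^⊛ℝ_mod)}` (Cor 4.8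
(iii), the same at every `j`) gives EXACTLY the weighted diagonal of the target — "elements of the form
`(1²·φ', 2²·φ', …)`" with `φ' = e(φ)`. [cite: Mochizuki2012, Rmk 4.8.1 (i) p.152] -/
theorem map_weightedDiagonal_addEquiv (e : Φ ≃+ Φ') :
    (weightedDiagonal Φ lstar).map (AddMonoidHom.compLeft e.toAddMonoidHom (Fin lstar)) =
      weightedDiagonal Φ' lstar :=
  map_weightedDiagonal_eq lstar e.toAddMonoidHom e.surjective

/-- The transported element, componentwise: `(e(x_j))_j` lies in the target weighted diagonal whenever `x` lies in
the source one ([IUTchII] Rmk 4.8.1 (i) p. 152). [cite: Mochizuki2012, Rmk 4.8.1 (i) p.152] -/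
theorem comp_mem_weightedDiagonal (e : Φ →+ Φ') {x : Fin lstar → Φ} (hx : x ∈ weightedDiagonal Φ lstar) :
    (fun i => e (x i)) ∈ weightedDiagonal Φ' lstar :=
  map_weightedDiagonal_le lstar e ⟨x, hx, rfl⟩

end Rmk481i

/-! ### 3. Remark 4.8.1 (ii): the local realified Gaussian monoid in `∏_j ℝ_{≥0}` and the poly-isomorphisms -/

section Rmk481ii

variable (lstar : ℕ)

/-- **[IUTchII] Rmk 4.8.1 (ii)** (p. 152 l. 26–38: "one may think of the realified Frobenioid, at each `v ∈ V`, of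
`ℱ_gau(†HT^Θ)^ℝ` as being naturally [«poly-»]embedded `ℱ_gau(†HT^Θ)^ℝ ↪ ∏_{j ∈ F_l^⋇} (†ℱ^ℝ_>)_j`"), at the divisor monoids of
the realifications (each `Φ_{(†ℱ^ℝ_>)_j,v} = ℝ_{≥0}`, pinned by its distinguished element): the image at `v` is the
submonoid of vectors `(1²·r, 2²·r, …, (l⋇)²·r)`, `r ∈ ℝ_{≥0}` — the `j²`-rays of Prop 4.1 (iv) / 4.3 (iv) assembled.
[cite: Mochizuki2012, Rmk 4.8.1 (ii) p.152] -/
theorem mem_weightedDiagonal_nnreal_iff (x : Fin lstar → ℝ≥0) :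
    x ∈ weightedDiagonal ℝ≥0 lstar ↔ ∃ r : ℝ≥0, ∀ i : Fin lstar, x i = ((i.val + 1) ^ 2 : ℕ) * r := by
  rw [mem_weightedDiagonal_iff]
  simp only [nsmul_eq_mul]

/-- **[IUTchII] Rmk 4.8.1 (ii)** (p. 152 l. 38–52: "by applying the full poly-isomorphisms `(†ℱ_>)_j ⥲ †ℱ_j` — which
are tautologically compatible with the labels `j ∈ F_l^⋇`! — we may think of `ℱ_gau(†HT^Θ)^ℝ` as being naturally
[«poly-»]embedded `ℱ_gau(†HT^Θ)^ℝ ↪ ∏_j †ℱ^ℝ_j`"), at the realified divisor monoids. Well-definedness: ANY two isomorphisms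
of pointed half-lines matching the distinguished elements COINCIDE (in the tree: `PointedHalfLine.addEquiv_eq_of_map_pt`,
abc-iut-L6-t2's `isoUnique_holds`), so every member of the full poly-isomorphism induces the SAME isomorphism of
realifications, namely a `scaleIso`; and relabelling
every factor of `∏_j ℝ_{≥0}` by the SAME isomorphism of pointed half-lines (the realification of a member of the full
poly-isomorphism `(†ℱ_>)_j ⥲ †ℱ_j`, the same `ℱ`-prime-strip at every `j`) carries the local realified Gaussian
monoid `{(j²·r)_j}` ONTO the local realified Gaussian monoid. [cite: Mochizuki2012, Rmk 4.8.1 (ii) p.152] -/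
theorem map_weightedDiagonal_scaleIso (A B : PointedHalfLine) :
    (weightedDiagonal ℝ≥0 lstar).map
        (AddMonoidHom.compLeft (PointedHalfLine.scaleIso A B).toAddMonoidHom (Fin lstar)) =
      weightedDiagonal ℝ≥0 lstar :=
  map_weightedDiagonal_addEquiv lstar (PointedHalfLine.scaleIso A B)

end Rmk481ii

/-! ### 4. Remark 4.8.1 (iii): the realified localization `C⊩_gau(†HT^Θ) → ℱ_gau(†HT^Θ)^ℝ` at the initial Θ-data -/

section Rmk481iii

variable {F : Type u} {K : Type v} {Fbar : Type w} [Field F] [NumberField F] [Field K]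
  [NumberField K] [Algebra F K] [Field Fbar] [Algebra F Fbar] [Algebra K Fbar]
  {E : WeierstrassCurve F} [E.IsElliptic] {l : ℕ} {P : BadPlacePredicates K}
  (D : InitialThetaData F K Fbar E l P)

/-- **[IUTchII] Rmk 4.8.1 (iii)** (p. 152 l. 53–67: the "realified localization" functor `C⊩_gau(†HT^Θ) → ℱ_gau(†HT^Θ)^ℝ`
induced by the localization functors `(†ℱ^⊛ℝ_mod)_j → †ℱ^ℝ_j` of Cor 4.8 (iii) and the embeddings of (i), (ii)), at the
divisor monoids of the REAL initial Θ-data: reading, label by label, the `v`-component of an element of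
`Φ_{C⊩_gau} = phiGau D` through [IUTchI] Ex 3.5 (i)'s local comparison `ρ_w` (`w ∈ V(K)` over `v ∈ V_mod`) lands in
the local realified Gaussian monoid `{(j²·r)_j} ⊆ ∏_j ℝ_{≥0}` of (ii). [cite: Mochizuki2012, Rmk 4.8.1 (iii) p.152] -/
theorem rho_phiGau_mem_weightedDiagonal {x : Fin (lStar l) → D.PhiMod} (hx : x ∈ phiGau D) (w : Val K) :
    (fun i => D.rho w (x i (Val.restrict (fieldOfModuli E) (Val.restrict F w)))) ∈
      weightedDiagonal ℝ≥0 (lStar l) := by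
  obtain ⟨φ, hφ⟩ := (mem_phiGau_iff D x).1 hx
  refine (mem_weightedDiagonal_nnreal_iff (lStar l) _).2
    ⟨D.rho w (φ (Val.restrict (fieldOfModuli E) (Val.restrict F w))), fun i => ?_⟩
  rw [hφ i, Finsupp.smul_apply, map_nsmul, nsmul_eq_mul]

/-- **[IUTchII] Rmk 4.8.1 (iii)** (p. 152 l. 62–67: "compatible … with the realified localization isomorphisms
`Φ_{C⊩_gau(†HT^Θ),v} ⥲ Ψ_{ℱ_gau}(†HT^Θ)^ℝ_v`, for `v ∈ V`, considered in Corollary 4.6, (v)"), at the REAL initial Θ-data: on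
the global formal evaluation isomorphism `thtToGau D : Φ_{C⊩_tht} ⥲ Φ_{C⊩_gau}` (p406619) the realified localization at
`w` IS the local weighted diagonal `r ↦ (j²·r)_j` of the local value `r = ρ_w(φ_v)` — the square "global
evaluation, then localize = localize, then local evaluation" commutes. [cite: Mochizuki2012, Rmk 4.8.1 (iii) p.152] -/
theorem rho_thtToGau_eq_weightedDiagonalHom (φ : D.PhiTht) (w : Val K) :
    (fun i => D.rho w (((thtToGau D φ : phiGau D) : Fin (lStar l) → D.PhiMod) i
        (Val.restrict (fieldOfModuli E) (Val.restrict F w)))) =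
      weightedDiagonalHom ℝ≥0 (lStar l)
        (D.rho w (D.modToTht.symm φ (Val.restrict (fieldOfModuli E) (Val.restrict F w)))) := by
  funext i
  rw [rho_thtToGau]
  simp [weightedDiagonalHom, sqWeight, nsmul_eq_mul]

end Rmk481iii

/-! ### 5. Remark 4.6.1: the nonarchimedean distinguished element is intrinsic, the archimedean one is not -/

/-- **[IUTchII] Rmk 4.6.1**, nonarchimedean clause (p. 139 l. 86–94: "in the case of `v ∈ V^non`, the poly-isomorphism
`Ψ^ss_{†ℱ⊢_v} ⥲ Ψ^ss_cns(†G_v)` of Proposition 4.2, (ii) …, may be reconstructed algorithmically from `†ℱ⊢_v`"), its kernel: the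
value monoid `Ψ_{†ℱ⊢_v}/Ψ^×_{†ℱ⊢_v} ≅ ℕ` has NO nontrivial automorphism — every additive automorphism of `ℕ` is the identity — so
the distinguished element "determined by the unique generator" (Prop 4.2 (ii)) is preserved by every automorphism of
`†ℱ⊢_v`. [cite: Mochizuki2012, Rmk 4.6.1 p.139] -/
theorem Nat.addEquiv_map_one (e : ℕ ≃+ ℕ) : e 1 = 1 := by
  obtain ⟨m, hm⟩ := e.surjective 1
  have h : e (m • 1) = m • e 1 := map_nsmul e m 1
  rw [smul_eq_mul, mul_one, hm, smul_eq_mul] at h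
  exact Nat.eq_one_of_mul_eq_one_left h.symm

/-- … hence every additive automorphism of `ℕ` is the identity ([IUTchII] Rmk 4.6.1, nonarchimedean clause, p. 139).
(The same statement is `Summit.ABC.IUTFork.addEquiv_nat_eq_refl` of the fork skeleton `ForkStrips.lean`, which a
Literature file cannot import; restated here for the L6 record.) [cite: Mochizuki2012, Rmk 4.6.1 p.139] -/
theorem Nat.addEquiv_eq_refl (e : ℕ ≃+ ℕ) : e = AddEquiv.refl ℕ := by
  refine AddEquiv.ext fun n => ?_
  rw [AddEquiv.refl_apply]
  have h : e (n • 1) = n • e 1 := map_nsmul e n 1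
  rw [Nat.addEquiv_map_one, smul_eq_mul, mul_one] at h
  simpa using h

section Rmk461Arch

open GoodPrimeKummer

/-- Norm of `z·|z|` for a nonzero complex number of norm `≤ 1`: `‖z‖²`, again in `(0, 1]`.
[cite: Mochizuki2012, Rmk 4.6.1 p.140] -/
theorem norm_mul_ofReal_norm (z : ℂ) : ‖z * (‖z‖ : ℂ)‖ = ‖z‖ * ‖z‖ := by
  rw [norm_mul, Complex.norm_real, Real.norm_eq_abs, abs_of_nonneg (norm_nonneg z)]

/-- **[IUTchII] Rmk 4.6.1**, archimedean clause (p. 139 l. 94 – p. 140 l. 15: "in the case of `v ∈ V^arc`, it is not possible to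
reconstruct algorithmically [the non-unit portion of] the corresponding poly-isomorphism `Ψ^ss_{†ℱ⊢_v} ⥲ Ψ^ss_cns(𝒟⊢_v)` of
Proposition 4.4, (ii), from `†ℱ⊢_v`. That is to say, … the distinguished element of `Ψ^ss_{†ℱ⊢_v}` [i.e., of `Ψ^R_{†ℱ⊢_v}`] is not
preserved by arbitrary automorphisms of `†ℱ⊢_v`"), WITNESSED at the model `𝒪^▷_ℂ` (abc-iut-L5-t2's `unitDiscMonoid ℂ`; the
distinguished class = the elements of norm `e⁻¹`, `GoodPrimeKummer.expNegOne`, Prop 4.4 (ii) "`p_v = e`"): the monoid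
automorphism `z ↦ z·|z|` of `𝒪^▷_ℂ` carries the distinguished element to an element of norm `e⁻²`, which is NOT in the
distinguished class modulo units (`associated_iff_norm_eq`). [cite: Mochizuki2012, Rmk 4.6.1 p.140] -/
theorem exists_mulEquiv_unitDisc_not_associated :
    ∃ φ : unitDiscMonoid ℂ ≃* unitDiscMonoid ℂ,
      ¬ Associated (φ (expNegOne ℂ)) (expNegOne ℂ) := by
  -- the endomorphism `z ↦ z·|z|`
  have hmem : ∀ z : unitDiscMonoid ℂ, (z : ℂ) * (‖(z : ℂ)‖ : ℂ) ∈ unitDiscMonoid ℂ := fun z =>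
    ⟨mul_ne_zero z.2.1 (by exact_mod_cast norm_ne_zero_iff.2 z.2.1),
      by rw [norm_mul_ofReal_norm]; exact mul_le_one₀ z.2.2 (norm_nonneg _) z.2.2⟩
  let f : unitDiscMonoid ℂ →* unitDiscMonoid ℂ :=
    { toFun := fun z => ⟨(z : ℂ) * (‖(z : ℂ)‖ : ℂ), hmem z⟩
      map_one' := Subtype.ext (by simp)
      map_mul' := fun z w => Subtype.ext (by
        simp only [Submonoid.coe_mul, norm_mul, Complex.ofReal_mul]
        ring) }
  have hf : ∀ z : unitDiscMonoid ℂ, ((f z : unitDiscMonoid ℂ) : ℂ) = (z : ℂ) * (‖(z : ℂ)‖ : ℂ) := fun _ => rfl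
  have hnorm : ∀ z : unitDiscMonoid ℂ, ‖((f z : unitDiscMonoid ℂ) : ℂ)‖ = ‖(z : ℂ)‖ * ‖(z : ℂ)‖ := fun z => by
    rw [hf, norm_mul_ofReal_norm]
  -- injective: norms agree (squares agree), then divide
  have hinj : Function.Injective f := by
    intro z w h
    have h' : (z : ℂ) * (‖(z : ℂ)‖ : ℂ) = (w : ℂ) * (‖(w : ℂ)‖ : ℂ) := by
      rw [← hf, ← hf, h]
    have hn : ‖(z : ℂ)‖ = ‖(w : ℂ)‖ := by
      have h2 : ‖(z : ℂ)‖ * ‖(z : ℂ)‖ = ‖(w : ℂ)‖ * ‖(w : ℂ)‖ := by rw [← hnorm, ← hnorm, h]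
      nlinarith [norm_nonneg (z : ℂ), norm_nonneg (w : ℂ), sq_nonneg (‖(z : ℂ)‖ - ‖(w : ℂ)‖),
        sq_nonneg (‖(z : ℂ)‖ + ‖(w : ℂ)‖), norm_pos_iff.2 z.2.1, norm_pos_iff.2 w.2.1]
    rw [hn] at h'
    have hw0 : ((‖(w : ℂ)‖ : ℝ) : ℂ) ≠ 0 := by exact_mod_cast norm_ne_zero_iff.2 w.2.1
    exact Subtype.ext (mul_right_cancel₀ hw0 h')
  -- surjective: `w / √‖w‖ ↦ w`
  have hsurj : Function.Surjective f := by
    intro w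
    have hw : 0 < ‖(w : ℂ)‖ := norm_pos_iff.2 w.2.1
    have hs : 0 < Real.sqrt ‖(w : ℂ)‖ := Real.sqrt_pos.2 hw
    have hs1 : Real.sqrt ‖(w : ℂ)‖ ≤ 1 := Real.sqrt_le_one.mpr w.2.2
    have hzmem : (w : ℂ) * ((Real.sqrt ‖(w : ℂ)‖)⁻¹ : ℝ) ∈ unitDiscMonoid ℂ := by
      refine ⟨mul_ne_zero w.2.1 (by exact_mod_cast (inv_pos.2 hs).ne'), ?_⟩
      rw [norm_mul, Complex.norm_real, Real.norm_eq_abs, abs_of_pos (inv_pos.2 hs)]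
      have : ‖(w : ℂ)‖ * (Real.sqrt ‖(w : ℂ)‖)⁻¹ = Real.sqrt ‖(w : ℂ)‖ := by
        rw [mul_inv_eq_iff_eq_mul₀ hs.ne', Real.mul_self_sqrt hw.le]
      rw [this]
      exact hs1
    refine ⟨⟨_, hzmem⟩, Subtype.ext ?_⟩
    rw [hf]
    change (w : ℂ) * ((Real.sqrt ‖(w : ℂ)‖)⁻¹ : ℝ) * (‖(w : ℂ) * ((Real.sqrt ‖(w : ℂ)‖)⁻¹ : ℝ)‖ : ℂ) = (w : ℂ)
    rw [norm_mul, Complex.norm_real, Real.norm_eq_abs, abs_of_pos (inv_pos.2 hs)]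
    have : ‖(w : ℂ)‖ * (Real.sqrt ‖(w : ℂ)‖)⁻¹ = Real.sqrt ‖(w : ℂ)‖ := by
      rw [mul_inv_eq_iff_eq_mul₀ hs.ne', Real.mul_self_sqrt hw.le]
    rw [this, mul_assoc, ← Complex.ofReal_mul, inv_mul_cancel₀ hs.ne', Complex.ofReal_one, mul_one]
  refine ⟨MulEquiv.ofBijective f ⟨hinj, hsurj⟩, fun hA => ?_⟩
  have h1 : ‖(((MulEquiv.ofBijective f ⟨hinj, hsurj⟩) (expNegOne ℂ) : unitDiscMonoid ℂ) : ℂ)‖ =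
      Real.exp (-1) * Real.exp (-1) := by
    rw [MulEquiv.ofBijective_apply, hnorm, norm_expNegOne]
  have h2 := associated_iff_norm_eq.1 hA
  rw [h1, norm_expNegOne, ← Real.exp_add] at h2
  have := Real.exp_injective h2
  norm_num at this

end Rmk461Arch

/-! ### 6. Remark 4.7.6 (v2 append): "label-crushing" — the quotient of the torsor of labels by `F_l^⋇` is one point -/

section Rmk476

variable {G : Type u} [Group G] {T : Type v} [MulAction G T]

/-- **[IUTchII] Rmk 4.7.6** (p. 148 l. 46 – p. 149 l. 4: "one cannot simply «form the quotient by the indeterminacy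
constituted by these `F_l^⋇`-symmetries» since this would give rise to «label-crushing», i.e., to identifying to a single
point the distinct labels `j ∈ F_l^⋇`, which play a crucial role in the construction of the Gaussian monoids"), its
kernel at abc-iut-L5's torsor of labels ([IUTchI] Def 4.1 (ii) "`LabCusp(†𝔇_v)` admits a natural `F_l^⋇`-torsor
structure", `IsTorsor`): in a `G`-torsor ANY two labels lie in the same `G`-orbit — the orbit quotient is ONE point.
[cite: Mochizuki2012, Rmk 4.7.6 p.148] -/
theorem IsTorsor.orbitRel_of_isTorsor (h : IsTorsor G T) (s t : T) : MulAction.orbitRel G T s t := by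
  obtain ⟨g, hg, -⟩ := h.existsUnique_smul_eq t s
  exact ⟨g, hg⟩

/-- **[IUTchII] Rmk 4.7.6**, "label-crushing" (p. 149 l. 1–4): the quotient of a `G`-torsor of labels by `G` is a
single point. [cite: Mochizuki2012, Rmk 4.7.6 p.149] -/
theorem IsTorsor.subsingleton_orbitRel_quotient (h : IsTorsor G T) :
    Subsingleton (MulAction.orbitRel.Quotient G T) := by
  refine ⟨fun a b => ?_⟩
  induction a using Quotient.inductionOn with
  | h s =>
    induction b using Quotient.inductionOn with
    | h t => exact Quotient.sound (IsTorsor.orbitRel_of_isTorsor h s t)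

/-- **[IUTchII] Rmk 4.7.6** (p. 148–149), the same in the form used for labelled data: a `G`-INVARIANT assignment
on a `G`-torsor of labels (an object "formed as the quotient by the `F_l^⋇`-symmetries") takes ONE value — the distinct
labels `j ∈ F_l^⋇` are crushed to a single datum. [cite: Mochizuki2012, Rmk 4.7.6 p.149] -/
theorem IsTorsor.eq_of_invariant {β : Type w} (h : IsTorsor G T) (f : T → β)
    (hf : ∀ (g : G) (t : T), f (g • t) = f t) (s t : T) : f s = f t := by
  obtain ⟨g, hg, -⟩ := h.existsUnique_smul_eq t s
  rw [← hg, hf]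

end Rmk476

/-! ### 7. Remark 4.6.1 (v3 append), nonarchimedean clause AT THE MODEL `Ψ/Ψ^× ≅ ℕ` -/

section Rmk461Nonarch
open GoodPrimeKummer
variable {Ψ : Type u} [CommMonoid Ψ]

/-- **[IUTchII] Rmk 4.6.1**, nonarchimedean clause at the model (p. 139 l. 86–94; Prop 4.2 (ii) p. 124 l. 26–31 "the
distinguished element … determined by the unique generator of `Ψ_{†ℱ⊢_v}/Ψ^×_{†ℱ⊢_v}`"): for ANY commutative monoid `Ψ` with
`Ψ/Ψ^× = Associates Ψ ≅ ℕ` ([IUTchI] Ex 3.3: `𝒪^▷_{𝒞⊢_v} = 𝒪^× · p_v^ℕ`), EVERY automorphism `φ` of `Ψ` preserves EVERY class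
modulo units — the induced automorphism of `Ψ/Ψ^×` (`assocCongr`, p418389) is an automorphism of `ℕ`, hence the identity
(`Nat.addEquiv_eq_refl`); so the generator class, the distinguished element of the realification and the
poly-isomorphism `Ψ^ss_{†ℱ⊢_v} ⥲ Ψ^ss_cns(†G_v)` are `Aut(†ℱ⊢_v)`-invariant ("may be reconstructed algorithmically from `†ℱ⊢_v`").
[cite: Mochizuki2012, Rmk 4.6.1 p.139] -/
theorem associatesMk_apply_eq_of_equiv_nat (e : Associates Ψ ≃* Multiplicative ℕ) (φ : Ψ ≃* Ψ) (p : Ψ) :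
    Associates.mk (φ p) = Associates.mk p := by
  let θ : Multiplicative ℕ ≃* Multiplicative ℕ := e.symm.trans ((assocCongr φ).trans e)
  have hθ : ∀ n : ℕ, θ (Multiplicative.ofAdd n) = Multiplicative.ofAdd n := fun n => by
    have hn := AddEquiv.congr_fun (Nat.addEquiv_eq_refl (AddEquiv.toMultiplicative.symm θ)) n
    rw [AddEquiv.refl_apply] at hn
    change Multiplicative.toAdd (θ (Multiplicative.ofAdd n)) = n at hn
    exact ((ofAdd_toAdd (θ (Multiplicative.ofAdd n))).symm).trans (by rw [hn])
  have h1 : θ (e (Associates.mk p)) = e (Associates.mk p) := by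
    rw [← ofAdd_toAdd (e (Associates.mk p))]
    exact hθ _
  have h2 : θ (e (Associates.mk p)) = e (Associates.mk (φ p)) := by
    change e (assocCongr φ (e.symm (e (Associates.mk p)))) = _
    rw [e.symm_apply_apply, assocCongr_mk]
  exact e.injective (h2.symm.trans h1)

/-- Contrapositive ([IUTchII] Rmk 4.6.1, p. 139–140): a monoid with an automorphism MOVING some class modulo
units (as `𝒪^▷_ℂ`, `exists_mulEquiv_unitDisc_not_associated`) cannot have `Ψ/Ψ^× ≅ ℕ`. [cite: Mochizuki2012, Rmk 4.6.1 p.140] -/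
theorem isEmpty_equiv_nat_of_moves_class (φ : Ψ ≃* Ψ) {p : Ψ} (hp : ¬ Associated (φ p) p) :
    IsEmpty (Associates Ψ ≃* Multiplicative ℕ) :=
  ⟨fun e => hp (Associates.mk_eq_mk_iff_associated.1 (associatesMk_apply_eq_of_equiv_nat e φ p))⟩

/-- So `𝒪^▷_ℂ/𝒪^×_ℂ` is NOT `ℕ`: no "unique generator" at `v ∈ 𝕍^arc`. [cite: Mochizuki2012, Rmk 4.6.1 p.140] -/
theorem isEmpty_associates_unitDisc_equiv_nat : IsEmpty (Associates (unitDiscMonoid ℂ) ≃* Multiplicative ℕ) := by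
  obtain ⟨φ, hφ⟩ := exists_mulEquiv_unitDisc_not_associated
  exact isEmpty_equiv_nat_of_moves_class φ hφ

end Rmk461Nonarch

end Literature.IUT.HodgeArakelov
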